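import Summits.QuantumFields.YangMills.Theorems.UnitScaleTiltProp7SectET3HilbertLettersT3
import HarnessLib

/-!
# Route `UnitScaleTilt`, crux «MinimiserStabilityRegPr» (stmt-QuantumFields-19200, stub EX) ∕ (O″χ) B0 (stmt-QuantumFields-20520), node N06(d = 3), route (α) —
# DEFINITIONS FILE, LAYER 0 BRICK L0c: **THE GAUGE PROJECTOR `R(U₀)` OF [Balaban1985BackgroundPropagators] (3.21) AT A T³ MEMBER, IN THE INTRINSIC FORM RULED BY
# ★★OWNER ym3-torus-plan g26 ACK 32 (q1)**: the residual gauge algebra `N_S(U₀) := ker (Q(U₀) ∘ D_{U₀})` of the averaging of record `Q := QTwS` (the gauge directions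
# the linearised constraint does not see) and `R_S(U₀) :=` the orthogonal projection onto `Δ^η_{U₀} N_S(U₀)` in the weighted `L²` space of the gauge parameters
# (`B11Eq103H1Complex.RLatticeK` at the member's letters of brick L0a)

Cell `ym-inputs` (desk `pub/ym-inputs`, INPUT-LIST.md v6 §4 row p01 = I-06 B0 DEFINER LEAD, layer 0 = the (L2)∕(L4)∕(L6) DEFINITION programme of WANTED №g25-1; memo
`pub/ym-inputs/DEFINER-MEMO-T3.md` §2 L0c; seat `ym-inputs-p01`).  YM₃ on T³ is ladder rung R3, NOT the Clay problem; nothing here is a claim about a stub, a crux, d = 4 or the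
mass gap.  `--supports stmt-QuantumFields-20520` (B0 of (O″χ) needs N06(d = 3), RULING g26-№2 (4)); count-neutral; review lane (definitions only — the rows are the def-free
sibling `UnitScaleTiltProp7SectET3GaugeProjectorT3Rows`).

THE PRINT.  [Balaban1985BackgroundPropagators] p. 394: *«R = R(U) is an orthogonal projection in the Hilbert space L²(Ω₀, 𝔤) onto the subspace ℛ = Δ^η_U N(Q′), N(Q′) = {λ :
Q′λ = 0}. (3.21)»*, with `Q′_j(U)` the linear parts of the averaging operations for gauge transformations ((3.18)–(3.19) p.393, «operations defined by (78)–(80) in [5]»); p. 418: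
*«(Q D λ)(c) = (Q′λ)(c₊) − (Q′λ)(c₋) = (D Q′λ)(c). (3.114) Iterating this identity we obtain finally Q_jDλ = D_jQ′_jλ, (3.115) … In particular they imply that the averages QA are
invariant with respect to gauge transformations λ satisfying Q′λ = 0, i.e. λ ∈ N(Q′).»*; p. 420: *«RD*GQ* = 0, hence QGDR = 0. (3.124)»*.

THE RULING (★★OWNER ACK 32 (q1), `pub/ym3-torus/STATUS.md` 2026-08-28T08:54:08Z, verbatim in substance).  For the route's averaging of record `Q := QTwS` (the symmetric covariant tube,
RULING g26-№12 (3)) the space `N(Q′)` is taken INTRINSICALLY as `N_S(U₀) := ker (QL2 U₀ ∘ DL2 U₀)` — the property print USES of `N(Q′)` in (3.121)–(3.125) is exactly «`Q(Dλ) = 0` for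
`λ ∈ N(Q′)`» ((3.115)), which holds on `N_S` BY CONSTRUCTION — and `R_S(U₀) := RLatticeK η⁻¹ (R(U₀)) (R(U₀)⁻¹) (Q ∘ D)` = the orthogonal projection onto `Δ^η_{U₀} N_S(U₀)`; print's comb
`Q′(U₀)` of (3.18)–(3.19) (for which `N(Q′) ⊆ N_S` by (3.115), with equality at `U₀ = 1` up to the `D`-kernel, which `Δ^η_{U₀} = D*D` annihilates — so NO mean-free cut is needed) is to be
typed later only as a comparison definition if an N06 size is ever stated in `Q′`-letters.  The EX display's Landau member becomes the S-twin `IsLandauPrintS U₀ X :⟺ R_S(U₀)(D*_{U₀}X) = 0`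
(filed by the (α-S) engine seat, not here).

WHAT IS DEFINED (member `F : T3Family`, heights `h : n ≤ K`, weights `c₀, cB` as in L0a, background `U₀`):
* **`QDS F n K h c₀ cB U₀ := QL2 … U₀ ∘ₗ DL2 … U₀`** — the linearised constraint on the gauge directions, `λ ↦ Q(U₀)(D_{U₀}λ)` (print's `Q_kD = D_kQ′_k`, (3.115));
* **`NS F n K h c₀ cB U₀ := ker (QDS … U₀)`** — the residual gauge algebra `N_S(U₀)` (print's `N(Q′)`, intrinsic form);
* **`RS F n K h c₀ cB U₀ := RLatticeK η⁻¹ (adBg F K U₀) (adBgInv F K U₀) (QDS … U₀)`** — print's `R(U₀)` (3.21): the orthogonal projection onto `Δ^η_{U₀} N_S(U₀)` in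
  `SiteL2K ℂ 3 (periodsT3 F K) c₀ W₂`;
* **`RSPi … U₀ := toL2S⁻¹ ∘ RS U₀ ∘ toL2S`** and **`DstarPi … U₀ := toL2S⁻¹ ∘ DstarL2 U₀ ∘ toL2`** — the same operators READ BACK on the route carriers (so that a consumer may write
  the Landau member `R(U₀)D*_{U₀}X = 0` on the route's `X : PBond (F.P K) 0 → M₂(ℂ)` as `RSPi U₀ (DstarPi U₀ X) = 0`).
Glue (by `rfl`∕unfolding): `QDS_apply`, `mem_NS_iff`, `RS_eq_projR` (`RS U₀ = B11Eq103H1Complex.projR (covLapSite U₀) (QDS U₀)`), `RSPi_apply`, `DstarPi_apply`.  The rows («orthogonal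
projection»: symmetric, idempotent, range `= Δ N_S`, fixes `Δ N_S`; `Q(Dλ) = 0` on `N_S`) are the def-free sibling.
HONEST SCOPE.  Definitions; no estimate; no claim that `R_S = ` print's comb `R` at `U₀ ≠ 1` (they agree at `U₀ = 1`; the difference is the located «by analogy» of RULING g26-№12);
not a proof of any stub; nothing continuum ∕ OS ∕ mass-gap ∕ Clay.

References: T. Bałaban, CMP **99** (1985) 389–434 [Balaban1985BackgroundPropagators] ((3.18)–(3.23) pp.393–394, (3.114)–(3.115) p.418, (3.121)–(3.126) pp.419–420);
CMP **96** (1984) 223–250 [Balaban1984PropagatorsII] ((2.7)–(2.12) pp.224–225: the flat `N(Q′)`, `R`).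
-/

set_option autoImplicit false

noncomputable section

open scoped InnerProductSpace ComplexConjugate Matrix.Norms.L2Operator BigOperators

namespace Summit.QuantumFields.YangMills.Theorems.Prop7SectET3GaugeProjector

open Literature.MathematicalPhysics.QuantumFieldTheory.Balaban1983to89
open Literature.MathematicalPhysics.QuantumFieldTheory.Balaban1983to89.T3ContinuumYM3Torus
open T3SectALandauChart (eta)
open B4Sect5Torus (TSite)
open B9SectCLatticeCarrier (Bond)
open B9Eq311L2Pairing (WL2)
open B11Eq103H1Complex (SiteL2K BondL2K RLatticeK projR covLaplaceSiteK)
open Summit.QuantumFields.YangMills.Theorems.Prop7SectET3Transport (periodsT3)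
open Summit.QuantumFields.YangMills.Theorems.Prop7SectET3HilbertLetters (W₂ adBg adBgInv toL2 toL2S QL2 DL2 DstarL2 covLapSite covLapSite_eq)

variable (F : T3Family) (n K : ℕ) (h : n ≤ K) (c₀ cB : ℝ) [Fact (0 < c₀)]

/-- **THE LINEARISED CONSTRAINT ON THE GAUGE DIRECTIONS, `λ ↦ Q(U₀)(D_{U₀}λ)`** — print's `Q_kDλ` of (3.114)–(3.115) for the averaging of record `Q := QTwS` read on `L²` (brick L0a's
`QL2`) and the covariant derivative (3.3) (`DL2`). [cite: Balaban1985BackgroundPropagators, (3.114)–(3.115) p.418] -/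
def QDS (U₀ : GaugeField (F.P K) 0 (Matrix.specialUnitaryGroup (Fin 2) ℂ)) : SiteL2K ℂ 3 (periodsT3 F K) c₀ W₂ →ₗ[ℂ] WL2 ℂ (fun _ : PBond (F.P n) 0 => cB) W₂ :=
  QL2 F n K h c₀ cB U₀ ∘ₗ DL2 F n K c₀ U₀

/-- **THE RESIDUAL GAUGE ALGEBRA `N_S(U₀) := ker (Q(U₀) ∘ D_{U₀})`** — the gauge directions invisible to the linearised constraint; print's `N(Q′) = {λ : Q′λ = 0}` in the
INTRINSIC form ruled for the symmetric tube (★★OWNER ACK 32 (q1)): «the averages QA are invariant with respect to gauge transformations λ ∈ N(Q′)» (p. 418) holds on `N_S`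
by construction. [cite: Balaban1985BackgroundPropagators, (3.21) p.394, (3.115) p.418] -/
def NS (U₀ : GaugeField (F.P K) 0 (Matrix.specialUnitaryGroup (Fin 2) ℂ)) : Submodule ℂ (SiteL2K ℂ 3 (periodsT3 F K) c₀ W₂) :=
  LinearMap.ker (QDS F n K h c₀ cB U₀)

/-- **PRINT'S GAUGE PROJECTOR `R(U₀)` (3.21) AT THE MEMBER, INTRINSIC FORM `R_S(U₀)`**: the orthogonal projection, in the weighted `L²` space of the gauge parameters, onto
`ℛ_S = Δ^η_{U₀} N_S(U₀)` — `B11Eq103H1Complex.RLatticeK` at spacing `η⁻¹`, transporters `R(U₀(b))^{±1}` of brick L0a, and `Q′ := Q(U₀) ∘ D_{U₀}`.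
[cite: Balaban1985BackgroundPropagators, (3.20)–(3.23) p.394] -/
def RS (U₀ : GaugeField (F.P K) 0 (Matrix.specialUnitaryGroup (Fin 2) ℂ)) : SiteL2K ℂ 3 (periodsT3 F K) c₀ W₂ →ₗ[ℂ] SiteL2K ℂ 3 (periodsT3 F K) c₀ W₂ :=
  RLatticeK (((eta F n K : ℝ) : ℂ)⁻¹) (adBg F K U₀) (adBgInv F K U₀) (QDS F n K h c₀ cB U₀)

/-- **`R_S(U₀)` READ BACK ON THE ROUTE'S GAUGE PARAMETERS** `Site (F.P K) 0 → M₂(ℂ)` (conjugation by brick L0a's `toL2S`). [cite: Balaban1985BackgroundPropagators, (3.21) p.394] -/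
def RSPi (U₀ : GaugeField (F.P K) 0 (Matrix.specialUnitaryGroup (Fin 2) ℂ)) : (Site (F.P K) 0 → Matrix (Fin 2) (Fin 2) ℂ) →ₗ[ℂ] (Site (F.P K) 0 → Matrix (Fin 2) (Fin 2) ℂ) :=
  (toL2S F K c₀).symm.toLinearMap ∘ₗ RS F n K h c₀ cB U₀ ∘ₗ (toL2S F K c₀).toLinearMap

/-- **`D*_{U₀}` READ BACK ON THE ROUTE CARRIERS**: vector fields `PBond (F.P K) 0 → M₂(ℂ)` to gauge parameters `Site (F.P K) 0 → M₂(ℂ)` (conjugation of brick L0a's `DstarL2`), so that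
the Landau member «`R(U₀)D*_{U₀}X = 0`» of (3.110)∕[Balaban1985Variational] (45) is statable on the route's `X` as `RSPi U₀ (DstarPi U₀ X) = 0`.
[cite: Balaban1985BackgroundPropagators, (3.8) p.392, (3.110) p.417] -/
def DstarPi (U₀ : GaugeField (F.P K) 0 (Matrix.specialUnitaryGroup (Fin 2) ℂ)) : (PBond (F.P K) 0 → Matrix (Fin 2) (Fin 2) ℂ) →ₗ[ℂ] (Site (F.P K) 0 → Matrix (Fin 2) (Fin 2) ℂ) :=
  (toL2S F K c₀).symm.toLinearMap ∘ₗ DstarL2 F n K c₀ U₀ ∘ₗ (toL2 F K c₀).toLinearMap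

variable {F n K h c₀ cB}

/-- Unfolding: `QDS U₀ λ = Q(U₀)(D_{U₀}λ)`. [cite: Balaban1985BackgroundPropagators, (3.115) p.418] -/
theorem QDS_apply (U₀ : GaugeField (F.P K) 0 (Matrix.specialUnitaryGroup (Fin 2) ℂ)) (l : SiteL2K ℂ 3 (periodsT3 F K) c₀ W₂) :
    QDS F n K h c₀ cB U₀ l = QL2 F n K h c₀ cB U₀ (DL2 F n K c₀ U₀ l) := rfl

/-- Membership in the residual gauge algebra: `λ ∈ N_S(U₀) ↔ Q(U₀)(D_{U₀}λ) = 0`. [cite: Balaban1985BackgroundPropagators, (3.21) p.394, (3.115) p.418] -/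
theorem mem_NS_iff (U₀ : GaugeField (F.P K) 0 (Matrix.specialUnitaryGroup (Fin 2) ℂ)) (l : SiteL2K ℂ 3 (periodsT3 F K) c₀ W₂) :
    l ∈ NS F n K h c₀ cB U₀ ↔ QL2 F n K h c₀ cB U₀ (DL2 F n K c₀ U₀ l) = 0 := LinearMap.mem_ker

/-- `R_S(U₀)` IS `B11Eq103H1Complex.projR` of the member's covariant site Laplacian (3.23) and the linearised constraint: the orthogonal projection onto `(N_S).map Δ^η_{U₀}`.
[cite: Balaban1985BackgroundPropagators, (3.21)–(3.23) p.394] -/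
theorem RS_eq_projR (U₀ : GaugeField (F.P K) 0 (Matrix.specialUnitaryGroup (Fin 2) ℂ)) :
    RS F n K h c₀ cB U₀ = projR (covLapSite F n K c₀ U₀) (QDS F n K h c₀ cB U₀) := by
  rw [RS, RLatticeK, covLapSite_eq]

/-- Unfolding the readback of `R_S`. [cite: Balaban1985BackgroundPropagators, (3.21) p.394] -/
theorem RSPi_apply (U₀ : GaugeField (F.P K) 0 (Matrix.specialUnitaryGroup (Fin 2) ℂ)) (l : Site (F.P K) 0 → Matrix (Fin 2) (Fin 2) ℂ) :
    RSPi F n K h c₀ cB U₀ l = (toL2S F K c₀).symm (RS F n K h c₀ cB U₀ (toL2S F K c₀ l)) := rfl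

/-- Unfolding the readback of `D*_{U₀}`. [cite: Balaban1985BackgroundPropagators, (3.8) p.392] -/
theorem DstarPi_apply (U₀ : GaugeField (F.P K) 0 (Matrix.specialUnitaryGroup (Fin 2) ℂ)) (A : PBond (F.P K) 0 → Matrix (Fin 2) (Fin 2) ℂ) :
    DstarPi F n K c₀ U₀ A = (toL2S F K c₀).symm (DstarL2 F n K c₀ U₀ (toL2 F K c₀ A)) := rfl

end Summit.QuantumFields.YangMills.Theorems.Prop7SectET3GaugeProjector

end
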